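import Literature.Algebra.Polynomial.CrossSequences
import Literature.Algebra.Polynomial.UmbralConnectionConstants
import Mathlib.Tactic
import HarnessLib

/-!
# The cross-sequence `M_n^{[λ]} = (I − D)^{−λ} xⁿ` and the Laguerre polynomials of arbitrary order (Rota–Kahaner–Odlyzko §11)

G.-C. Rota, D. Kahaner, A. Odlyzko, *Finite operator calculus* (1973), §11 "Laguerre
polynomials", pp. 726–728:

> One of the simplest cross-sequences is `M_n^{[λ]} (x) = (I − D)^{−λ} xⁿ`, or, more explicitly,
> `M_n^{[λ]} (x) = Σ_{k≥0} C(n,k) (λ + k − 1)_k x^{n−k}`. These polynomials seem to have a scarce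
> literature. … Note that for `λ = 1` they give, after dividing by `n!`, the partial sums of the
> exponential function. From the properties of cross-sequences we immediately infer that
> `M_n^{[λ+μ]} (x) = Σ_{k≥0} C(n,k) (λ + k − 1)_k M_{n−k}^{[μ]} (x)`, as well as
> `M_n^{[λ+μ]} (x + y) = Σ_{k≥0} C(n,k) M_k^{[λ]} (x) M_{n−k}^{[μ]} (y)`, which explains several
> classical binomial identities. Moreover, since the `M_n^{[λ]} (x)` are an Appell set, Corollary 2
> to Theorem 7 implies the composition law `M^{[λ]} (M^{[μ]} (x)) = M^{[λ+μ]} (x)`.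
> The cross-sequence `M_n^{[λ]} (x)` is related to polynomials of Laguerre type …
> (p. 728) We shall be concerned with Laguerre type sets relative to the operators (Laguerre
> operators of order `α`): `K_α = K/(I − D)^{α+1}`. … The Sheffer sets relative to these operators
> are polynomial sets `L_n^{(α)} (x)`, classically known as Laguerre polynomials of order `α`. …
> `L_n^{(α)} (x) = (I − D)^{α+1} L_n (x)`, `(I − D)^β L_n^{(α)} (x) = L_n^{(α+β)} (x)`. We infer …
> `L_n^{(α)} (x) = (−1)ⁿ (I − D)^{α+n} xⁿ = (−1)ⁿ Σ_{k≥0} (−1)^k C(α+n, k) D^k xⁿ`.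
> (p. 729) The binomial theorem for Sheffer polynomials yields
> `L_n^{(α)} (x + y) = Σ_k C(n,k) L_k (x) L_{n−k}^{(α)} (y)`; whence … the first composition law
> `L_n^{(α+β+1)} (x + y) = Σ_k C(n,k) L_k^{(α)} (x) L_{n−k}^{(β)} (y)`. Further properties follow from
> `L_n^{(α)} (x) = (−1)ⁿ M_n^{[−α−n]} (x)`. … `L^{(α)} (L^{(β)} (x)) = (I − D)^{β−α} xⁿ = M_n^{[α−β]} (x)`
> … For `β = α` we obtain the remarkable identity `L^{(α)} (L^{(α)} (x)) = xⁿ`, showing that all the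
> Laguerre polynomials are self-inverse sets.

Here `λ, μ, α, β` range over the field `K` (characteristic `0`). The operator `(I − D)^{−λ}` for
`λ ∈ K` is, as on RKO p. 716, the exponential `exp (−λ log (I − D)) = e^{λF} (D)` of the generator
`F = −log (1 − t) = Σ_{n≥1} tⁿ/n` — the tree's `expOp F λ` of `CrossSequences.lean`; for integral
`λ = ∓m` it IS `(I − D)^{±m}` (`expOp_negLogOneSub_neg_natCast`, `expOp_negLogOneSub_natCast`), and
`e^{λF} = Σ_k (λ)^{(k)} tᵏ/k!` (`(λ)^{(k)} = λ(λ+1)⋯(λ+k−1) = (λ + k − 1)_k`, the tree's generating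
function `egf_ascPochhammer`). The tree's `laguerreSheffer K m n = (I − D)^m L_n` (integral order
`α = m − 1`, `LaguerreBasicSequence.lean`) is the special case `laguerreOrder (m − 1) n`
(`laguerreOrder_natCast_sub_one`).

Definitions (with bodies): `laguerreCross a n = M_n^{[a]}`, `laguerreOrder α n = L_n^{(α)}`.
Main statements: `isCrossSequence_laguerreCross`, `laguerreCross_eq_sum` (the explicit form),
`laguerreCross_one_eq_sum` / `inv_factorial_smul_laguerreCross_one` (partial sums of `eˣ`),
`laguerreCross_add_eq_sum`, `laguerreCross_add_eval_add` (the two identities),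
`isAppellSequence_laguerreCross`, `umbralComp_laguerreCross` (composition law),
`laguerreOrder_natCast_sub_one`, `isShefferSequence_laguerreOrder`, `expOp_laguerreOrder`
(`(I − D)^β L^{(α)} = L^{(α+β)}`), `laguerreOrder_eq_smul_expOp` (`L_n^{(α)} = (−1)ⁿ (I − D)^{α+n} xⁿ`),
`laguerreOrder_eq_smul_laguerreCross` (`L_n^{(α)} = (−1)ⁿ M_n^{[−α−n]}`, p. 729), `laguerreOrder_eq_smul_sum`
(the coefficients, with `C(α+n, k) = (α+n)_k/k!`), and p. 729: `negLogOneSub_subst_laguerreSeries`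
(`F (π (t)) = −F (t)` for the Laguerre involution `π = t/(t − 1)`), `umbralComp_laguerreOrder`
(`L^{(α)} (L^{(β)}) = (I − D)^{β−α} xⁿ = M^{[α−β]}`), `umbralComp_laguerreOrder_self` (self-inverse for
every `α ∈ K`), `umbralComp_laguerreCross_laguerreOrder` (`M^{[α]} (L^{(β)}) = L^{(α+β)}`),
`laguerreOrder_add_add_one_eval_add` (first composition law).

## References
* [RotaKahanerOdlyzko1973] G.-C. Rota, D. Kahaner, A. Odlyzko, *On the foundations of
  combinatorial theory VIII. Finite operator calculus*, J. Math. Anal. Appl. 42 (1973) 684–760,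
  §11 pp. 726–728 (and §8 p. 716 for `P^{−λ} = exp (−λF)`).
-/

noncomputable section

open Polynomial Finset

namespace Literature.Algebra.Polynomial

variable {K : Type*} [Field K] [CharZero K]

/-! ## The generator `F = −log (1 − t)` and the operators `(I − D)^{−λ} = e^{λF}` -/

variable (K) in
/-- `F = −log (1 − t)` has no constant term (it is a generator, `F (1) = 0`).
[cite: RotaKahanerOdlyzko1973, §8 (generators), p. 716] -/
theorem constantCoeff_negLogOneSub :
    PowerSeries.constantCoeff (-PowerSeries.rescale (-1) (PowerSeries.log K)) = 0 := by
  rw [map_neg, constantCoeff_rescale_neg_one_log, neg_zero]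

/-- **`e^{λF} = Σ_k (λ)^{(k)} tᵏ/k!`** for `F = −log (1 − t)` (the tree's `egf_ascPochhammer`), i.e.
`(I − D)^{−λ} = exp (λF)(D)` is the composition operator `Σ_k (λ + k − 1)_k D^k/k!`.
[cite: RotaKahanerOdlyzko1973, §11 ("`M_n^{[λ]} (x) = (I − D)^{−λ} xⁿ`, or, more explicitly …"), p. 726] -/
theorem expOp_negLogOneSub_eq (a : K) :
    expOp (-PowerSeries.rescale (-1) (PowerSeries.log K)) a =
      diffOp (PowerSeries.mk fun k => (ascPochhammer K k).eval a / (k.factorial : K)) := by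
  rw [expOp_eq, ← egf_ascPochhammer]

/-- `e^{−F} = 1 − t`: `expOp F (−1) = I − D`. [cite: RotaKahanerOdlyzko1973, §11, p. 726] -/
theorem expOp_negLogOneSub_neg_one :
    expOp (-PowerSeries.rescale (-1) (PowerSeries.log K)) (-1) = diffOp (1 - PowerSeries.X) := by
  rw [expOp_eq, rescale_neg_one_subst_eq_subst_neg K _ (constantCoeff_negLogOneSub K), neg_neg,
    subst_rescale_eq_rescale_subst _ PowerSeries.constantCoeff_log, exp_subst_log, map_add, map_one,
    PowerSeries.rescale_neg_one_X, ← sub_eq_add_neg]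

/-- `e^{F} = (1 − t)⁻¹`: `expOp F 1 = (I − D)⁻¹`. [cite: RotaKahanerOdlyzko1973, §11, p. 726] -/
theorem expOp_negLogOneSub_one :
    expOp (-PowerSeries.rescale (-1) (PowerSeries.log K)) 1 = diffOp (1 - PowerSeries.X)⁻¹ := by
  rw [expOp_eq, PowerSeries.rescale_one, RingHom.id_apply, exp_subst_neg_log_one_sub]

/-- **`(I − D)^m = e^{−mF}`** for natural `m`: the exponential group through `I − D` passes through
its integral powers. [cite: RotaKahanerOdlyzko1973, §11, pp. 726, 728] -/
theorem expOp_negLogOneSub_neg_natCast (m : ℕ) :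
    expOp (-PowerSeries.rescale (-1) (PowerSeries.log K)) (-(m : K)) = diffOp ((1 - PowerSeries.X) ^ m) := by
  induction m with
  | zero => rw [Nat.cast_zero, neg_zero, expOp_zero, pow_zero, diffOp_one]
  | succ m ih =>
    rw [Nat.cast_succ, neg_add, expOp_add (constantCoeff_negLogOneSub K), ih, expOp_negLogOneSub_neg_one,
      ← diffOp_mul, pow_succ]

/-- **`(I − D)^{−m} = e^{mF}`** for natural `m`. [cite: RotaKahanerOdlyzko1973, §11, p. 726] -/
theorem expOp_negLogOneSub_natCast (m : ℕ) :
    expOp (-PowerSeries.rescale (-1) (PowerSeries.log K)) (m : K) = diffOp ((1 - PowerSeries.X)⁻¹ ^ m) := by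
  induction m with
  | zero => rw [Nat.cast_zero, expOp_zero, pow_zero, diffOp_one]
  | succ m ih =>
    rw [Nat.cast_succ, expOp_add (constantCoeff_negLogOneSub K), ih, expOp_negLogOneSub_one,
      ← diffOp_mul, pow_succ]

/-! ## The cross-sequence `M_n^{[λ]}` -/

/-- **The cross-sequence `M_n^{[λ]} (x) = (I − D)^{−λ} xⁿ`** (`λ ∈ K`; `(I − D)^{−λ} = exp (λF)(D)`,
`F = −log (1 − t)`). [cite: RotaKahanerOdlyzko1973, §11, p. 726] -/
def laguerreCross (a : K) (n : ℕ) : K[X] :=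
  expOp (-PowerSeries.rescale (-1) (PowerSeries.log K)) a (X ^ n)

/-- Unfolding. [cite: RotaKahanerOdlyzko1973, §11, p. 726] -/
theorem laguerreCross_eq (a : K) (n : ℕ) :
    laguerreCross a n = expOp (-PowerSeries.rescale (-1) (PowerSeries.log K)) a (X ^ n) :=
  rfl

/-- **"One of the simplest cross-sequences is `M_n^{[λ]}`"** (Theorem 8 with the generator
`F = −log (1 − t)` and `p_n = xⁿ`). [cite: RotaKahanerOdlyzko1973, §11, p. 726] -/
theorem isCrossSequence_laguerreCross : IsCrossSequence (laguerreCross (K := K)) :=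
  isCrossSequence_expOp (constantCoeff_negLogOneSub K) isBinomialType_X_pow

/-- `M_n^{[−m]} = (I − D)^m xⁿ` for natural `m`. [cite: RotaKahanerOdlyzko1973, §11, p. 726] -/
theorem laguerreCross_neg_natCast (m n : ℕ) :
    laguerreCross (-(m : K)) n = diffOp ((1 - PowerSeries.X) ^ m) (X ^ n) := by
  rw [laguerreCross_eq, expOp_negLogOneSub_neg_natCast]

/-- `M_n^{[m]} = ((I − D)⁻¹)^m xⁿ` for natural `m`. [cite: RotaKahanerOdlyzko1973, §11, p. 726] -/
theorem laguerreCross_natCast (m n : ℕ) :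
    laguerreCross (m : K) n = diffOp ((1 - PowerSeries.X)⁻¹ ^ m) (X ^ n) := by
  rw [laguerreCross_eq, expOp_negLogOneSub_natCast]

/-- `M_n^{[0]} = xⁿ`. [cite: RotaKahanerOdlyzko1973, §11, p. 726] -/
theorem laguerreCross_zero_left (n : ℕ) : laguerreCross (0 : K) n = X ^ n := by
  rw [laguerreCross_eq, expOp_zero, LinearMap.id_apply]

/-- `M_0^{[λ]} = 1`. [cite: RotaKahanerOdlyzko1973, §11, p. 726] -/
theorem laguerreCross_zero_right (a : K) : laguerreCross a 0 = 1 := by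
  rw [laguerreCross_eq, pow_zero, expOp_apply_one (constantCoeff_negLogOneSub K)]

/-- **The explicit form `M_n^{[λ]} (x) = Σ_{k=0}^{n} C(n,k) (λ + k − 1)_k x^{n−k}`**
(`(λ + k − 1)_k = λ(λ+1)⋯(λ+k−1)`, Mathlib's `ascPochhammer`).
[cite: RotaKahanerOdlyzko1973, §11, p. 726] -/
theorem laguerreCross_eq_sum (a : K) (n : ℕ) :
    laguerreCross a n =
      ∑ k ∈ range (n + 1), ((n.choose k : K) * (ascPochhammer K k).eval a) • X ^ (n - k) := by
  rw [laguerreCross_eq, expOp_negLogOneSub_eq, diffOp_apply_X_pow]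
  refine sum_congr rfl fun k _ => ?_
  rw [PowerSeries.coeff_mk, Nat.descFactorial_eq_factorial_mul_choose, Nat.cast_mul]
  have hk : (k.factorial : K) ≠ 0 := Nat.cast_ne_zero.2 (Nat.factorial_ne_zero k)
  congr 1
  field_simp

/-- **`M_n^{[λ]} (0) = (λ + n − 1)_n`** (the constant term of the explicit form).
[cite: RotaKahanerOdlyzko1973, §11, p. 726] -/
theorem laguerreCross_eval_zero (a : K) (n : ℕ) :
    (laguerreCross a n).eval 0 = (ascPochhammer K n).eval a := by
  rw [laguerreCross_eq_sum, eval_finsetSum, sum_eq_single n]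
  · rw [Nat.choose_self, Nat.cast_one, one_mul, Nat.sub_self, pow_zero, eval_smul, eval_one,
      smul_eq_mul, mul_one]
  · intro k hk hkn
    have hk' : k < n := lt_of_le_of_ne (Nat.lt_succ_iff.1 (mem_range.1 hk)) hkn
    rw [eval_smul, eval_pow, eval_X, zero_pow (Nat.sub_ne_zero_of_lt hk'), smul_zero]
  · exact fun h => absurd (self_mem_range_succ n) h

/-- **`λ = 1`: `M_n^{[1]} (x) = Σ_k (n)_k x^{n−k} = Σ_j n!/j! · xʲ`** ("for `λ = 1` they give, after
dividing by `n!`, the partial sums of the exponential function"), first form.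
[cite: RotaKahanerOdlyzko1973, §11, p. 726] -/
theorem laguerreCross_one_eq_sum (n : ℕ) :
    laguerreCross (1 : K) n = ∑ k ∈ range (n + 1), (n.descFactorial k : K) • X ^ (n - k) := by
  rw [laguerreCross_eq_sum]
  refine sum_congr rfl fun k _ => ?_
  rw [ascPochhammer_eval_one, Nat.descFactorial_eq_factorial_mul_choose, Nat.cast_mul, mul_comm]

/-- **`M_n^{[1]}/n! = Σ_{j=0}^{n} xʲ/j!`, the `n`-th partial sum of the exponential series.**
[cite: RotaKahanerOdlyzko1973, §11, p. 726] -/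
theorem inv_factorial_smul_laguerreCross_one (n : ℕ) :
    (n.factorial : K)⁻¹ • laguerreCross (1 : K) n = ∑ j ∈ range (n + 1), ((j.factorial : K)⁻¹) • X ^ j := by
  rw [laguerreCross_one_eq_sum, smul_sum, ← sum_range_reflect]
  refine sum_congr rfl fun j hj => ?_
  have hjn : j ≤ n := Nat.lt_succ_iff.1 (mem_range.1 hj)
  rw [smul_smul, Nat.add_sub_cancel, Nat.sub_sub_self hjn]
  congr 1
  have hn : (n.factorial : K) ≠ 0 := Nat.cast_ne_zero.2 (Nat.factorial_ne_zero n)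
  have hj' : (j.factorial : K) ≠ 0 := Nat.cast_ne_zero.2 (Nat.factorial_ne_zero j)
  have h := Nat.factorial_mul_descFactorial (Nat.sub_le n j)
  rw [Nat.sub_sub_self hjn] at h
  have h' : (j.factorial : K) * (n.descFactorial (n - j) : K) = (n.factorial : K) := by exact_mod_cast h
  field_simp
  linear_combination h'

/-- **`M_n^{[λ+μ]} (x + y) = Σ_{k=0}^{n} C(n,k) M_k^{[λ]} (x) M_{n−k}^{[μ]} (y)`** ("which explains several
classical binomial identities"). [cite: RotaKahanerOdlyzko1973, §11, p. 727] -/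
theorem laguerreCross_add_eval_add (a b : K) (n : ℕ) (x y : K) :
    (laguerreCross (a + b) n).eval (x + y) =
      ∑ k ∈ range (n + 1), (n.choose k : K) * (laguerreCross a k).eval x * (laguerreCross b (n - k)).eval y :=
  isCrossSequence_laguerreCross.eval_add a b n x y

omit [CharZero K] in
/-- The cross identity (*) at `x = 0`, read as a polynomial identity in `y`:
`p_n^{[λ+μ]} = Σ_k C(n,k) p_k^{[λ]} (0) · p_{n−k}^{[μ]}`. [cite: RotaKahanerOdlyzko1973, §8 (*), p. 712] -/
theorem IsCrossSequence.apply_add_eq_sum' [CharZero K] {p : K → ℕ → K[X]} (hp : IsCrossSequence p)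
    (a b : K) (n : ℕ) :
    p (a + b) n = ∑ k ∈ range (n + 1), ((n.choose k : K) * (p a k).eval 0) • p b (n - k) := by
  apply Polynomial.funext
  intro y
  rw [← zero_add y, hp.eval_add a b n 0 y, zero_add, eval_finsetSum]
  exact sum_congr rfl fun k _ => by rw [eval_smul, smul_eq_mul]

/-- **`M_n^{[λ+μ]} (x) = Σ_{k=0}^{n} C(n,k) (λ + k − 1)_k M_{n−k}^{[μ]} (x)`** ("from the properties of
cross-sequences we immediately infer"). [cite: RotaKahanerOdlyzko1973, §11, p. 726] -/
theorem laguerreCross_add_eq_sum (a b : K) (n : ℕ) :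
    laguerreCross (a + b) n =
      ∑ k ∈ range (n + 1), ((n.choose k : K) * (ascPochhammer K k).eval a) • laguerreCross b (n - k) := by
  rw [isCrossSequence_laguerreCross.apply_add_eq_sum' a b n]
  simp only [laguerreCross_eval_zero]

/-- **"The `M_n^{[λ]} (x)` are an Appell set"** (for each `λ`).
[cite: RotaKahanerOdlyzko1973, §11, p. 727] -/
theorem isAppellSequence_laguerreCross (a : K) : IsAppellSequence (laguerreCross a) :=
  isBasicSequence_derivative_X_pow.isShefferSequence_map isDeltaOperator_derivative
    (isShiftInvariant_expOp _ a) (by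
      rw [expOp_apply_one (constantCoeff_negLogOneSub K)]
      exact one_ne_zero)

/-- `(M_n^{[λ]})' = n M_{n−1}^{[λ]}`. [cite: RotaKahanerOdlyzko1973, §11, p. 727] -/
theorem derivative_laguerreCross_succ (a : K) (n : ℕ) :
    derivative (laguerreCross a (n + 1)) = ((n + 1 : ℕ) : K) • laguerreCross a n :=
  (isAppellSequence_laguerreCross a).map_succ n

/-- **The composition law `M^{[λ]} (M^{[μ]} (x)) = M^{[λ+μ]} (x)`** (umbral composition of Appell
sets, Corollary 2 to Theorem 7; the tree's `umbralComp s t n = s_n (t (x))`).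
[cite: RotaKahanerOdlyzko1973, §11, p. 727] -/
theorem umbralComp_laguerreCross (a b : K) :
    umbralComp (laguerreCross a) (laguerreCross b) = laguerreCross (a + b) := by
  funext n
  have h := umbralComp_appell_eq_diffOp (s := laguerreCross a) (t := laguerreCross b)
    ((PowerSeries.rescale a (PowerSeries.exp K)).subst (-PowerSeries.rescale (-1) (PowerSeries.log K)))
    ((PowerSeries.rescale b (PowerSeries.exp K)).subst (-PowerSeries.rescale (-1) (PowerSeries.log K)))
    (fun n => rfl) (fun n => rfl) n
  rw [h, rescale_exp_subst_mul (constantCoeff_negLogOneSub K), add_comm b a]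
  rfl

/-- The composition law is commutative: `M^{[λ]} (M^{[μ]}) = M^{[μ]} (M^{[λ]})`.
[cite: RotaKahanerOdlyzko1973, §11, p. 727] -/
theorem umbralComp_laguerreCross_comm (a b : K) :
    umbralComp (laguerreCross a) (laguerreCross b) = umbralComp (laguerreCross b) (laguerreCross a) := by
  rw [umbralComp_laguerreCross, umbralComp_laguerreCross, add_comm]

/-! ## The Laguerre polynomials of arbitrary order `α ∈ K` -/

/-- **The Laguerre polynomials of order `α`**: `L_n^{(α)} = (I − D)^{α+1} L_n`
(`(I − D)^{α+1} = exp (−(α+1) F)(D)`, `F = −log (1 − t)`; `L_n` the basic Laguerre polynomials of the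
tree's `laguerreBasic`). [cite: RotaKahanerOdlyzko1973, §11, p. 728] -/
def laguerreOrder (α : K) (n : ℕ) : K[X] :=
  expOp (-PowerSeries.rescale (-1) (PowerSeries.log K)) (-(α + 1)) (laguerreBasic K n)

/-- Unfolding. [cite: RotaKahanerOdlyzko1973, §11, p. 728] -/
theorem laguerreOrder_eq (α : K) (n : ℕ) :
    laguerreOrder α n = expOp (-PowerSeries.rescale (-1) (PowerSeries.log K)) (-(α + 1)) (laguerreBasic K n) :=
  rfl

/-- **Integral orders**: `L_n^{(m−1)} = (I − D)^m L_n` is the tree's `laguerreSheffer K m n`.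
[cite: RotaKahanerOdlyzko1973, §11, p. 728] -/
theorem laguerreOrder_natCast_sub_one (m n : ℕ) :
    laguerreOrder ((m : K) - 1) n = laguerreSheffer K m n := by
  rw [laguerreOrder_eq, sub_add_cancel, expOp_negLogOneSub_neg_natCast, laguerreSheffer_eq]

/-- `L_n^{(−1)} = L_n`, the basic Laguerre polynomials. [cite: RotaKahanerOdlyzko1973, §11, p. 728] -/
theorem laguerreOrder_neg_one (n : ℕ) : laguerreOrder (-1 : K) n = laguerreBasic K n := by
  rw [laguerreOrder_eq, neg_add_cancel, neg_zero, expOp_zero, LinearMap.id_apply]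

/-- `L_0^{(α)} = 1`. [cite: RotaKahanerOdlyzko1973, §11, p. 728] -/
theorem laguerreOrder_zero_right (α : K) : laguerreOrder α 0 = 1 := by
  rw [laguerreOrder_eq, laguerreBasic_zero, expOp_apply_one (constantCoeff_negLogOneSub K)]

/-- **`L_n^{(α)}` is a Sheffer set relative to the Laguerre operator `K = D/(D − I)`** ("the Sheffer
sets relative to these operators are … Laguerre polynomials of order `α`").
[cite: RotaKahanerOdlyzko1973, §11, p. 728] -/
theorem isShefferSequence_laguerreOrder (α : K) :
    IsShefferSequence (laguerreOperator K) (laguerreOrder α) :=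
  (isBasicSequence_laguerreBasic K).isShefferSequence_map (isDeltaOperator_laguerreOperator K)
    (isShiftInvariant_expOp _ _) (by
      rw [expOp_apply_one (constantCoeff_negLogOneSub K)]
      exact one_ne_zero)

/-- **`(I − D)^β L_n^{(α)} = L_n^{(α+β)}`** (`β ∈ K`). [cite: RotaKahanerOdlyzko1973, §11, p. 728] -/
theorem expOp_laguerreOrder (α β : K) (n : ℕ) :
    expOp (-PowerSeries.rescale (-1) (PowerSeries.log K)) (-β) (laguerreOrder α n) = laguerreOrder (α + β) n := by
  rw [laguerreOrder_eq, laguerreOrder_eq, ← LinearMap.comp_apply, ← expOp_add (constantCoeff_negLogOneSub K)]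
  congr 2
  ring

/-- `(I − D)^m L_n^{(α)} = L_n^{(α+m)}` for natural `m`. [cite: RotaKahanerOdlyzko1973, §11, p. 728] -/
theorem diffOp_one_sub_X_pow_laguerreOrder (m : ℕ) (α : K) (n : ℕ) :
    diffOp ((1 - PowerSeries.X) ^ m) (laguerreOrder α n) = laguerreOrder (α + m) n := by
  rw [← expOp_negLogOneSub_neg_natCast, expOp_laguerreOrder]

/-- **`L_n^{(α)} = (−1)ⁿ (I − D)^{α+n} xⁿ`** (from `L_n = (−1)ⁿ (I − D)^{n−1} xⁿ`, the tree's
`laguerreBasic_eq_smul_diffOp_one_sub_X_pow`). [cite: RotaKahanerOdlyzko1973, §11, p. 728] -/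
theorem laguerreOrder_eq_smul_expOp (α : K) (n : ℕ) :
    laguerreOrder α n =
      (-1 : K) ^ n • expOp (-PowerSeries.rescale (-1) (PowerSeries.log K)) (-(α + n)) (X ^ n) := by
  rw [laguerreOrder_eq, laguerreBasic_eq_smul_diffOp_one_sub_X_pow, map_smul,
    ← expOp_negLogOneSub_neg_natCast, ← LinearMap.comp_apply, ← expOp_add (constantCoeff_negLogOneSub K)]
  rcases n with _ | m
  · rw [pow_zero, one_smul, one_smul, pow_zero, expOp_apply_one (constantCoeff_negLogOneSub K),
      expOp_apply_one (constantCoeff_negLogOneSub K)]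
  · congr 3
    push_cast
    ring

/-- **`L_n^{(α)} = (−1)ⁿ M_n^{[−α−n]}`**: "the cross-sequence `M_n^{[λ]}` is related to polynomials of
Laguerre type". [cite: RotaKahanerOdlyzko1973, §11, pp. 727–728] -/
theorem laguerreOrder_eq_smul_laguerreCross (α : K) (n : ℕ) :
    laguerreOrder α n = (-1 : K) ^ n • laguerreCross (-(α + n)) n := by
  rw [laguerreOrder_eq_smul_expOp, laguerreCross_eq]

/-- **The coefficients of the Laguerre polynomials of order `α`**:
`L_n^{(α)} (x) = (−1)ⁿ Σ_{k=0}^{n} (−1)^k C(α+n, k) (n)_k x^{n−k}` with the generalized binomial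
coefficient `C(α+n, k) = (α+n)(α+n−1)⋯(α+n−k+1)/k!` (Mathlib's `descPochhammer`) and
`(n)_k = n!/(n−k)!`. [cite: RotaKahanerOdlyzko1973, §11, p. 728] -/
theorem laguerreOrder_eq_smul_sum (α : K) (n : ℕ) :
    laguerreOrder α n = (-1 : K) ^ n • ∑ k ∈ range (n + 1),
      ((-1 : K) ^ k * ((descPochhammer K k).eval (α + n) / (k.factorial : K)) * (n.descFactorial k : K)) •
        X ^ (n - k) := by
  rw [laguerreOrder_eq_smul_laguerreCross, laguerreCross_eq_sum]
  congr 1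
  refine sum_congr rfl fun k _ => ?_
  rw [ascPochhammer_eval_neg_eq_descPochhammer, Nat.descFactorial_eq_factorial_mul_choose, Nat.cast_mul]
  have hk : (k.factorial : K) ≠ 0 := Nat.cast_ne_zero.2 (Nat.factorial_ne_zero k)
  congr 1
  field_simp

/-- The binomial theorem for `L^{(α)}`: `L_n^{(α)} (x + y) = Σ_k C(n,k) L_k (x) L_{n−k}^{(α)} (y)`
(the Sheffer identity (S)). [cite: RotaKahanerOdlyzko1973, §11, p. 729] -/
theorem laguerreOrder_eval_add (α : K) (n : ℕ) (x y : K) :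
    (laguerreOrder α n).eval (x + y) =
      ∑ k ∈ range (n + 1), (n.choose k : K) * (laguerreBasic K k).eval x * (laguerreOrder α (n - k)).eval y :=
  (isShefferSequence_laguerreOrder α).eval_add (isDeltaOperator_laguerreOperator K)
    (isBasicSequence_laguerreBasic K) n x y

/-! ## Umbral composition of the Laguerre polynomials of arbitrary order (p. 729) -/

omit [CharZero K] in
/-- `((1 − t)⁻¹)⁻¹ = 1 − t`. [cite: RotaKahanerOdlyzko1973, §11, p. 729] -/
theorem one_sub_X_inv_inv :
    (((1 : PowerSeries K) - PowerSeries.X)⁻¹)⁻¹ = (1 : PowerSeries K) - PowerSeries.X := by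
  rw [PowerSeries.inv_eq_iff_mul_eq_one (by
      rw [PowerSeries.constantCoeff_inv]; exact inv_ne_zero (constantCoeff_one_sub_X_ne_zero K)),
    PowerSeries.mul_inv_cancel _ (constantCoeff_one_sub_X_ne_zero K)]

/-- `log` inverts `exp − 1` under composition: `log (1 + (e^{H} − 1)) = H` for `H (0) = 0`.
[cite: RotaKahanerOdlyzko1973, §8 (generators: `P = e^F`, `F = log (I + S)`), p. 716] -/
theorem log_subst_exp_subst_sub_one {H : PowerSeries K} (hH : PowerSeries.constantCoeff H = 0) :
    ((PowerSeries.log K).subst ((PowerSeries.exp K).subst H - 1) : PowerSeries K) = H := by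
  have hs := PowerSeries.HasSubst.of_constantCoeff_zero' hH
  have h1 : (PowerSeries.subst H ((PowerSeries.log K).subst (PowerSeries.exp K - 1) : PowerSeries K) : PowerSeries K) =
      PowerSeries.subst H (PowerSeries.X : PowerSeries K) := by
    rw [log_subst_exp_sub_one]
  rwa [PowerSeries.subst_comp_subst_apply PowerSeries.HasSubst.exp_sub_one hs, PowerSeries.subst_sub hs,
    powerSeries_one_subst hH, PowerSeries.subst_X hs] at h1

/-- **The generator `F = −log (1 − t)` is odd under the Laguerre involution `π (t) = t/(t − 1)`:
`F (π (t)) = −F (t)`**, i.e. `log (1 − t/(t − 1)) = −log (1 − t)` (the series shadow of `π ∘ π = t`,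
the self-inverse property of the Laguerre polynomials). [cite: RotaKahanerOdlyzko1973, §11, p. 729] -/
theorem negLogOneSub_subst_laguerreSeries :
    ((-PowerSeries.rescale (-1) (PowerSeries.log K)).subst
        (PowerSeries.X * (PowerSeries.X - 1 : PowerSeries K)⁻¹) : PowerSeries K) =
      PowerSeries.rescale (-1) (PowerSeries.log K) := by
  set F : PowerSeries K := -PowerSeries.rescale (-1) (PowerSeries.log K) with hFdef
  set π : PowerSeries K := PowerSeries.X * (PowerSeries.X - 1 : PowerSeries K)⁻¹ with hπdef
  have hπ0 : PowerSeries.constantCoeff π = 0 := by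
    rw [hπdef, map_mul, PowerSeries.constantCoeff_X, zero_mul]
  have hπs := PowerSeries.HasSubst.of_constantCoeff_zero' hπ0
  have hF0 : PowerSeries.constantCoeff F = 0 := constantCoeff_negLogOneSub K
  have hFπ0 : PowerSeries.constantCoeff (F.subst π : PowerSeries K) = 0 := by
    rw [powerSeries_constantCoeff_subst hπ0, hF0]
  -- `e^{F ∘ π} = (e^F) ∘ π = ((1 − t)⁻¹) ∘ π = (1 − π)⁻¹ = ((1 − t)⁻¹)⁻¹ = 1 − t`
  have hexp : ((PowerSeries.exp K).subst (F.subst π : PowerSeries K) : PowerSeries K) = 1 - PowerSeries.X := by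
    rw [← PowerSeries.subst_comp_subst_apply (PowerSeries.HasSubst.of_constantCoeff_zero' hF0) hπs,
      hFdef, exp_subst_neg_log_one_sub, powerSeries_inv_subst hπ0 (constantCoeff_one_sub_X_ne_zero K),
      PowerSeries.subst_sub hπs, powerSeries_one_subst hπ0, PowerSeries.subst_X hπs, hπdef,
      one_sub_X_mul_X_sub_one_inv, one_sub_X_inv_inv]
  -- take logarithms
  rw [← log_subst_exp_subst_sub_one hFπ0, hexp, sub_sub_cancel_left, PowerSeries.rescale_eq_subst,
    neg_one_smul K (PowerSeries.X : PowerSeries K)]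

/-- **`e^{cF} ∘ π = e^{−cF}`**: conjugating by the Laguerre involution inverts the group
`(I − D)^{−c} = e^{cF}` ("a trivial identification of the various operators at hand").
[cite: RotaKahanerOdlyzko1973, §11, p. 729] -/
theorem rescale_exp_subst_negLogOneSub_subst_laguerreSeries (c : K) :
    (PowerSeries.subst (PowerSeries.X * (PowerSeries.X - 1 : PowerSeries K)⁻¹)
        ((PowerSeries.rescale c (PowerSeries.exp K)).subst (-PowerSeries.rescale (-1) (PowerSeries.log K)) :
          PowerSeries K) : PowerSeries K) =
      (PowerSeries.rescale (-c) (PowerSeries.exp K)).subst (-PowerSeries.rescale (-1) (PowerSeries.log K)) := by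
  have hπ0 : PowerSeries.constantCoeff (PowerSeries.X * (PowerSeries.X - 1 : PowerSeries K)⁻¹) = 0 := by
    rw [map_mul, PowerSeries.constantCoeff_X, zero_mul]
  rw [PowerSeries.subst_comp_subst_apply (PowerSeries.HasSubst.of_constantCoeff_zero' (constantCoeff_negLogOneSub K))
      (PowerSeries.HasSubst.of_constantCoeff_zero' hπ0), negLogOneSub_subst_laguerreSeries,
    show PowerSeries.rescale (-c) (PowerSeries.exp K) = PowerSeries.rescale (-1) (PowerSeries.rescale c (PowerSeries.exp K)) by
      rw [PowerSeries.rescale_rescale, mul_neg_one],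
    rescale_neg_one_subst_eq_subst_neg K _ (constantCoeff_negLogOneSub K), neg_neg]

/-- **Umbral composition of two Laguerre sets of arbitrary orders**:
`L_n^{(α)} (L^{(β)} (x)) = (I − D)^{β−α} xⁿ = M_n^{[α−β]} (x)` (Theorem 7 with `q (p (t)) = t` for the
self-inverse Laguerre series). [cite: RotaKahanerOdlyzko1973, §11, p. 729]
[cite: RotaKahanerOdlyzko1973, §7 Theorem 7, p. 708] -/
theorem umbralComp_laguerreOrder (α β : K) (n : ℕ) :
    umbralComp (laguerreOrder α) (laguerreOrder β) n = laguerreCross (α - β) n := by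
  have h := umbralComp_eq_diffOp_apply (isDeltaOperator_diffOp_X_mul_X_sub_one_inv K)
    (isBasicSequence_laguerreBasic_diffOp K)
    ((PowerSeries.rescale (-(α + 1)) (PowerSeries.exp K)).subst (-PowerSeries.rescale (-1) (PowerSeries.log K)))
    ((PowerSeries.rescale (-(β + 1)) (PowerSeries.exp K)).subst (-PowerSeries.rescale (-1) (PowerSeries.log K)))
    (s := laguerreOrder α) (t := laguerreOrder β) (q := laguerreBasic K) (fun n => rfl) (fun n => rfl) n
  rw [h, umbralComp_laguerreBasic_self, rescale_exp_subst_negLogOneSub_subst_laguerreSeries, neg_neg,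
    rescale_exp_subst_mul (constantCoeff_negLogOneSub K), laguerreCross_eq, expOp_eq]
  congr 3
  ring

/-- **"All the Laguerre polynomials are self-inverse sets"**: `L_n^{(α)} (L^{(α)} (x)) = xⁿ` for every
`α ∈ K`. [cite: RotaKahanerOdlyzko1973, §11, p. 729] -/
theorem umbralComp_laguerreOrder_self (α : K) (n : ℕ) :
    umbralComp (laguerreOrder α) (laguerreOrder α) n = X ^ n := by
  rw [umbralComp_laguerreOrder, sub_self, laguerreCross_zero_left]

/-- The umbral operator `xⁿ ↦ L_n^{(α)}` is an involution.
[cite: RotaKahanerOdlyzko1973, §11, p. 729] -/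
theorem umbral_laguerreOrder_comp_self (α : K) :
    umbral (laguerreOrder α) ∘ₗ umbral (laguerreOrder α) = LinearMap.id :=
  (umbral_comp_umbral_eq_id_iff _ _).2 (funext (umbralComp_laguerreOrder_self α))

/-- **`M^{[α]} (L^{(β)} (x)) = L^{(α+β)} (x)`** ("umbral composition of `M_n^{[α]} (x)` with
`L_n^{(β)} (x)` gives, by an application of Theorem 7, … the Laguerre polynomials again!").
[cite: RotaKahanerOdlyzko1973, §11, p. 729] -/
theorem umbralComp_laguerreCross_laguerreOrder (α β : K) (n : ℕ) :
    umbralComp (laguerreCross α) (laguerreOrder β) n = laguerreOrder (α + β) n := by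
  have h := umbralComp_eq_diffOp_apply (isDeltaOperator_diffOp_X_mul_X_sub_one_inv K)
    (isBasicSequence_laguerreBasic_diffOp K)
    ((PowerSeries.rescale α (PowerSeries.exp K)).subst (-PowerSeries.rescale (-1) (PowerSeries.log K)))
    ((PowerSeries.rescale (-(β + 1)) (PowerSeries.exp K)).subst (-PowerSeries.rescale (-1) (PowerSeries.log K)))
    (s := laguerreCross α) (t := laguerreOrder β) (q := fun n => X ^ n) (fun n => rfl) (fun n => rfl) n
  rw [h, umbralComp_X_pow_left, rescale_exp_subst_negLogOneSub_subst_laguerreSeries,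
    rescale_exp_subst_mul (constantCoeff_negLogOneSub K), laguerreOrder_eq, expOp_eq]
  congr 3
  ring

/-- **The first composition law** `L_n^{(α+β+1)} (x + y) = Σ_k C(n,k) L_k^{(α)} (x) L_{n−k}^{(β)} (y)`
("upon applying the operator `(I − D)^{β+1}`" — here `(I − D)^{α+1}` in `x` — "to both sides" of the
binomial theorem). [cite: RotaKahanerOdlyzko1973, §11, p. 729] -/
theorem laguerreOrder_add_add_one_eval_add (α β : K) (n : ℕ) (x y : K) :
    (laguerreOrder (α + β + 1) n).eval (x + y) =
      ∑ k ∈ range (n + 1), (n.choose k : K) * (laguerreOrder α k).eval x * (laguerreOrder β (n - k)).eval y := by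
  -- the binomial theorem for `L^{(β)}` as a polynomial identity in `x`, hit with `(I − D)^{α+1}`
  have hS := isShefferSequence_laguerreOrder (K := K) β
  have h := congrArg (expOp (-PowerSeries.rescale (-1) (PowerSeries.log K)) (-(α + 1)))
    (hS.taylor_apply_eq_sum (isDeltaOperator_laguerreOperator K) (isBasicSequence_laguerreBasic K) y n)
  rw [(isShiftInvariant_expOp _ _).apply_taylor, map_sum, expOp_laguerreOrder,
    show β + (α + 1) = α + β + 1 by ring] at h
  have h' := congrArg (eval x) h
  rw [taylor_eval, eval_finsetSum] at h'
  rw [h']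
  exact sum_congr rfl fun k _ => by rw [map_smul, eval_smul, smul_eq_mul, ← laguerreOrder_eq]; ring

end Literature.Algebra.Polynomial
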